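import Summits.PneNP.PneNP.Theorems.ChebyshevTracialDesignPairContainmentCells
import Summits.PneNP.PneNP.Theorems.ChebyshevTracialDesignVertexTransitive
import HarnessLib

/-!
# Cell pnp-psdrank, route `ChebyshevTracialDesign`: the VIRTUAL IDENTITY `L_u = C_u` — summed over the matchings, the pair-containment form of
# every mask is EXACTLY minus the true second moment of the LINEAR form: `Σ_M Σ_U W(U,M) f(U)·(Σ_p u_p x_p x_{π_M p})² = −(#t-cuts)⁻¹·Σ_{|U|=t} f(U)·(Σ_{p∈U} u_p)²`;
# balanced slabs are MEAN-ZERO test masks for (CG_1') (crux `TracialDecayExp20`, stmt-PneNP-19878)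

Brick 105 (prover g19; MEMO-22 §1(e), §2(b)). Brick 104 proved `Σ_M Q^f_M(u) ≤ 0` for the pair-containment form `Q^f_M(u) = Σ_U W(U,M) f(U) C_u(U)²`,
`C_u(U) = Σ_p u_p x_p x_{π_M p}`, in every matching-independent direction `u`. This file computes the sum EXACTLY. For a `t`-cut `U` and
`p, q ∈ U` the matching sum `β_U(p,q) := Σ_M W(U,M)·1[π_M p ∈ U]·1[π_M q ∈ U]` does not depend on `(p,q)` beyond `[p = q]` (the stabiliser of `U`
in `𝔖_n` acts on the matchings preserving `W(U,·)` — `…LevelMarginals.cc_perm` — and the swaps of two vertices of `U` are transitive enough: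
§2–§3), while its row sums are design values of LEVEL POLYNOMIALS: `Σ_{q∈U} 1[π_M q ∈ U] = t − cc(U,M)` (`…PairContainmentCells.sum_containment_eq`),
so `Σ_{p,q} β_U = Σ_M W(U,M)(t−cc)² = −t²/#t-cuts` and `Σ_p β_U(p,p) = −t/#t-cuts` by exactness at degree `2` and the uniform row marginal
`|Q_c(t)| = #{M : cc(U,M) = c}·#t-cuts` (`…LevelMarginals.card_Qset_eq_rowCount_mul`). Hence
* §4 **`pairSum_eq`**: `Σ_M W(U,M)·1[π_M p ∈ U]·1[π_M q ∈ U] = −1/#{t-cuts}` for ALL `p, q ∈ U` (design of degree `D ≥ 2`): at the virtual level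
  every vertex of the cut is matched INSIDE the cut («`cc = 0`»), pairs included;
* §5 **`sum_containment_sq_eq_linear`**: `Σ_U Σ_M W(U,M) f(U) C_u(U)² = −(#t-cuts)⁻¹ Σ_{|U|=t} f(U)·L_u(U)²`, `L_u(U) = Σ_{p∈U} u_p`, for EVERY
  `f` (no sign, no degree) and every fixed `u` — the linear statistic `L_u` and the containment statistic `C_u` coincide virtually, and on
  `M`-average the pair-containment form of `f` is minus the genuine `f`-weighted second moment of `L_u` (brick 104's `≤ 0` with equality);
* §5 **`sum_containment_sq_eq_zero_of_slab`**: if `f` is supported on a SLAB `{L_u = 0}` (e.g. the balanced slabs `1[|U∩H₁| = |U∩H₂|]` with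
  `u = χ_{H₁} − χ_{H₂}`), then `Σ_M Q^f_M(u) = 0` EXACTLY — so (CG_1') in the fixed direction `u` demands `|Q^f_M(u)|` small for essentially every
  `M` (a two-sided rigidity, MEMO-22 §2(b); toy data: `|Q^f_M(u)| ≈ 0.13·|Q¹_M(u)|` of random sign at `(n,t) = (16,7)`, `D = 2`).
[cite: Rothvoss2017, §2 (PDF p. 6)] [cite: Grigoriev2001, Lemma 1.4 (PDF p. 8)] [cite: Potechin2019, Example 3.4 (LIPIcs 124, 61:7)]
[cite: GriblingDelaatLaurent2019, §5]
Stature: support/instrument (kernel lane, no defs, axioms standard). WHAT THIS IS NOT: no bound on `|Q^f_M(u)|` for individual `M` (that is the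
open rigidity), no proof or refutation of `TracialDecayExp20`, nothing on psd rank of P_PM(K_n), no P-vs-NP content. Supports stmt-PneNP-19878.
-/

set_option linter.dupNamespace false -- `Summit.PneNP.PneNP.…`: summit = sub-problem (D-0017)

noncomputable section

namespace Summit.PneNP.PneNP.Theorems.ChebyshevTracialDesignPairContainmentMean

open Finset Matrix Polynomial Literature.Barriers.PneNP Literature.Combinatorics.Optimization
open Summit.PneNP.PneNP.Theorems.ChebyshevTracialDesignLevelMarginals (cc_perm odd_card_image card_Qset_eq_rowCount_mul)
open Summit.PneNP.PneNP.Theorems.ChebyshevTracialDesignVertexTransitive (partner_smul)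
open Summit.PneNP.PneNP.Theorems.ChebyshevTracialDesignPairContainmentCells (levelWeight_mul sum_containment_eq)

variable {n : ℕ}

/-! ### §1 The weight at a cut: dependence on `cc` only, and its total -/

/-- The level weight depends on the matching only through the crossing number. [cite: Rothvoss2017, §2 (PDF p. 6)] -/
theorem levelWeight_congr (t : ℕ) (C : Finset ℕ) (w : ℕ → ℝ) {U : OddSet n} {M M' : PMatch n} (h : cc U M = cc U M') :
    levelWeight n t C w U M = levelWeight n t C w U M' := by
  classical
  unfold levelWeight
  refine sum_congr rfl fun c _ => ?_
  simp only [mem_Qset_iff, h]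

/-- **Total weight of a `t`-cut**: `Σ_M W(U,M) = (Σ_{c∈C} w_c)/#{t-cuts}` (uniform row marginal of the level classes).
[cite: Rothvoss2017, §2 (PDF p. 6)] -/
theorem sum_levelWeight_eq {t : ℕ} (C : Finset ℕ) (w : ℕ → ℝ) (hC : ∀ c ∈ C, (Qset n t c).Nonempty) {U : OddSet n} (hU : U.1.card = t) :
    ∑ M : PMatch n, levelWeight n t C w U M = (∑ c ∈ C, w c) / ((univ.filter fun U' : OddSet n => U'.1.card = t).card : ℝ) := by
  classical
  unfold levelWeight
  rw [sum_comm, sum_div]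
  refine sum_congr rfl fun c hc => ?_
  have hQ := card_Qset_eq_rowCount_mul t c U hU
  have hQ0 : ((Qset n t c).card : ℝ) ≠ 0 := by exact_mod_cast (hC c hc).card_pos.ne'
  have hrow0 : ((univ.filter fun M : PMatch n => cc U M = c).card : ℝ) ≠ 0 := fun h0 => hQ0 (by rw [hQ, h0, zero_mul])
  have htc0 : ((univ.filter fun U' : OddSet n => U'.1.card = t).card : ℝ) ≠ 0 := fun h0 => hQ0 (by rw [hQ, h0, mul_zero])
  have hsum : ∑ M : PMatch n, (if (U, M) ∈ Qset n t c then w c / ((Qset n t c).card : ℝ) else 0) =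
      ((univ.filter fun M : PMatch n => cc U M = c).card : ℝ) * (w c / ((Qset n t c).card : ℝ)) := by
    simp only [mem_Qset_iff, hU, true_and]
    rw [← sum_filter, sum_const, nsmul_eq_mul]
  rw [hsum, hQ]
  field_simp

/-- **Design value of a level polynomial at a cut**: for an exact design of degree `D` and `p` with `deg p ≤ D`,
`Σ_M W(U,M)·p(cc(U,M)) = −p(0)/#{t-cuts}`. [cite: Rothvoss2017, §2 (PDF p. 6)] [cite: CoppersmithRivlin1992, Thm. (p. 970)] -/
theorem sum_levelWeight_mul_eval_eq {t T D : ℕ} {Bv : ℝ} {C : Finset ℕ} {w : ℕ → ℝ} (hdes : IsExactDesign n t T D Bv C w)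
    (p : Polynomial ℝ) (hp : p.natDegree ≤ D) {U : OddSet n} (hU : U.1.card = t) :
    ∑ M : PMatch n, levelWeight n t C w U M * p.eval ((cc U M : ℕ) : ℝ) =
      -p.eval 0 / ((univ.filter fun U' : OddSet n => U'.1.card = t).card : ℝ) := by
  have hC : ∀ c ∈ C, (Qset n t c).Nonempty := fun c hc => (hdes.2.2.2.1 c hc).2.2.2
  have h1 : ∀ M : PMatch n, levelWeight n t C w U M * p.eval ((cc U M : ℕ) : ℝ) =
      levelWeight n t C (fun c => w c * p.eval (c : ℝ)) U M := fun M => by rw [levelWeight_mul]; ring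
  simp_rw [h1]
  rw [sum_levelWeight_eq C _ hC hU, hdes.2.2.2.2.2.1 p hp]

/-! ### §2 Swapping two vertices of the cut -/

/-- A swap of two members of `U` maps `U` to itself. [folklore] -/
theorem swap_mem_iff {U : Finset (Fin n)} {a b : Fin n} (ha : a ∈ U) (hb : b ∈ U) (x : Fin n) :
    Equiv.swap a b x ∈ U ↔ x ∈ U := by
  rcases eq_or_ne x a with rfl | hxa
  · rw [Equiv.swap_apply_left]; exact ⟨fun _ => ha, fun _ => hb⟩
  rcases eq_or_ne x b with rfl | hxb
  · rw [Equiv.swap_apply_right]; exact ⟨fun _ => hb, fun _ => ha⟩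
  rw [Equiv.swap_apply_of_ne_of_ne hxa hxb]

/-- A swap of two members of `U` fixes `U` as a set. [folklore] -/
theorem image_swap_eq {U : Finset (Fin n)} {a b : Fin n} (ha : a ∈ U) (hb : b ∈ U) : U.image (Equiv.swap a b) = U := by
  ext x
  constructor
  · intro hx
    obtain ⟨y, hy, rfl⟩ := mem_image.1 hx
    exact (swap_mem_iff ha hb y).2 hy
  · intro hx
    exact mem_image.2 ⟨Equiv.swap a b x, (swap_mem_iff ha hb x).2 hx, Equiv.swap_apply_self _ _ _⟩

/-- Relabelling by a swap inside `U` preserves the crossing number with `U`. [cite: Rothvoss2017, §2 (PDF p. 5)] -/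
theorem cc_swap_smul {U : OddSet n} {a b : Fin n} (ha : a ∈ U.1) (hb : b ∈ U.1) (M : PMatch n) :
    cc U (Equiv.swap a b • M) = cc U M := by
  have h := cc_perm (Equiv.swap a b) U M
  have hU : (⟨U.1.image (Equiv.swap a b), odd_card_image _ U⟩ : OddSet n) = U := Subtype.ext (image_swap_eq ha hb)
  rw [hU] at h
  exact h

/-- The two partner functions of the tree agree. [folklore] -/
theorem partner_eq_PMSol_partner (M : PMatch n) (v : Fin n) : M.2.partner v = PMSol.partner M v :=
  (M.2.eq_partner_of_mem (PMSol.mk_partner_mem M v)).symm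

/-- After a swap inside `U`, the partner of the swapped vertex is in `U` iff the old partner was. [folklore] -/
theorem partner_smul_mem_iff {U : OddSet n} {a b : Fin n} (ha : a ∈ U.1) (hb : b ∈ U.1) (M : PMatch n) (p : Fin n) :
    (Equiv.swap a b • M).2.partner (Equiv.swap a b p) ∈ U.1 ↔ M.2.partner p ∈ U.1 := by
  rw [partner_eq_PMSol_partner, partner_eq_PMSol_partner, partner_smul]
  exact swap_mem_iff ha hb _

/-! ### §3 The matching sums `β_U(p,q) = Σ_M W(U,M)·1[π p ∈ U]·1[π q ∈ U]` are swap-invariant -/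

/-- **Swap invariance**: for `a, b ∈ U`, `β_U(σp, σq) = β_U(p,q)` with `σ = (a b)`. [cite: Rothvoss2017, §2 (PDF p. 6)] -/
theorem pairSum_swap (t : ℕ) (C : Finset ℕ) (w : ℕ → ℝ) {U : OddSet n} {a b : Fin n} (ha : a ∈ U.1) (hb : b ∈ U.1) (p q : Fin n) :
    ∑ M : PMatch n, levelWeight n t C w U M *
        ((if M.2.partner (Equiv.swap a b p) ∈ U.1 then (1 : ℝ) else 0) * (if M.2.partner (Equiv.swap a b q) ∈ U.1 then (1 : ℝ) else 0)) =
      ∑ M : PMatch n, levelWeight n t C w U M *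
        ((if M.2.partner p ∈ U.1 then (1 : ℝ) else 0) * (if M.2.partner q ∈ U.1 then (1 : ℝ) else 0)) := by
  set σ : Equiv.Perm (Fin n) := Equiv.swap a b with hσ
  -- reindex the left-hand side by `M ↦ σ • M`
  rw [← Equiv.sum_comp (MulAction.toPerm σ) (fun M : PMatch n => levelWeight n t C w U M *
    ((if M.2.partner (σ p) ∈ U.1 then (1 : ℝ) else 0) * (if M.2.partner (σ q) ∈ U.1 then (1 : ℝ) else 0)))]
  refine sum_congr rfl fun M _ => ?_
  simp only [MulAction.toPerm_apply]
  rw [levelWeight_congr t C w (cc_swap_smul ha hb M)]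
  have hp := partner_smul_mem_iff ha hb M p
  have hq := partner_smul_mem_iff ha hb M q
  simp only [hσ] at hp hq ⊢
  rw [show (if (Equiv.swap a b • M).2.partner (Equiv.swap a b p) ∈ U.1 then (1 : ℝ) else 0) =
      (if M.2.partner p ∈ U.1 then (1 : ℝ) else 0) from by simp only [hp],
    show (if (Equiv.swap a b • M).2.partner (Equiv.swap a b q) ∈ U.1 then (1 : ℝ) else 0) =
      (if M.2.partner q ∈ U.1 then (1 : ℝ) else 0) from by simp only [hq]]

/-- **First-argument constancy off the diagonal**: for `p, p', q ∈ U` with `p ≠ q`, `p' ≠ q`: `β_U(p,q) = β_U(p',q)`. [folklore] -/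
theorem pairSum_eq_of_ne (t : ℕ) (C : Finset ℕ) (w : ℕ → ℝ) {U : OddSet n} {p p' q : Fin n} (hp : p ∈ U.1) (hp' : p' ∈ U.1)
    (hpq : p ≠ q) (hp'q : p' ≠ q) :
    ∑ M : PMatch n, levelWeight n t C w U M * ((if M.2.partner p ∈ U.1 then (1 : ℝ) else 0) * (if M.2.partner q ∈ U.1 then (1 : ℝ) else 0)) =
      ∑ M : PMatch n, levelWeight n t C w U M * ((if M.2.partner p' ∈ U.1 then (1 : ℝ) else 0) * (if M.2.partner q ∈ U.1 then (1 : ℝ) else 0)) := by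
  have h := pairSum_swap t C w hp hp' p q
  rw [Equiv.swap_apply_left, Equiv.swap_apply_of_ne_of_ne hpq.symm hp'q.symm] at h
  exact h.symm

/-- **Diagonal constancy**: for `p, p' ∈ U`: `β_U(p,p) = β_U(p',p')`. [folklore] -/
theorem pairSum_diag_eq (t : ℕ) (C : Finset ℕ) (w : ℕ → ℝ) {U : OddSet n} {p p' : Fin n} (hp : p ∈ U.1) (hp' : p' ∈ U.1) :
    ∑ M : PMatch n, levelWeight n t C w U M * ((if M.2.partner p ∈ U.1 then (1 : ℝ) else 0) * (if M.2.partner p ∈ U.1 then (1 : ℝ) else 0)) =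
      ∑ M : PMatch n, levelWeight n t C w U M * ((if M.2.partner p' ∈ U.1 then (1 : ℝ) else 0) * (if M.2.partner p' ∈ U.1 then (1 : ℝ) else 0)) := by
  have h := pairSum_swap t C w hp hp' p p
  rw [Equiv.swap_apply_left] at h
  exact h.symm

/-- Symmetry `β_U(p,q) = β_U(q,p)`. [folklore] -/
theorem pairSum_comm (t : ℕ) (C : Finset ℕ) (w : ℕ → ℝ) (U : OddSet n) (p q : Fin n) :
    ∑ M : PMatch n, levelWeight n t C w U M * ((if M.2.partner p ∈ U.1 then (1 : ℝ) else 0) * (if M.2.partner q ∈ U.1 then (1 : ℝ) else 0)) =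
      ∑ M : PMatch n, levelWeight n t C w U M * ((if M.2.partner q ∈ U.1 then (1 : ℝ) else 0) * (if M.2.partner p ∈ U.1 then (1 : ℝ) else 0)) :=
  sum_congr rfl fun M _ => by ring

/-- **Off-diagonal constancy**: for `p ≠ q` and `p₀ ≠ q₀` in `U`: `β_U(p,q) = β_U(p₀,q₀)`. [folklore] -/
theorem pairSum_offDiag_eq (t : ℕ) (C : Finset ℕ) (w : ℕ → ℝ) {U : OddSet n} {p q p₀ q₀ : Fin n} (hp : p ∈ U.1) (hq : q ∈ U.1)
    (hp₀ : p₀ ∈ U.1) (hq₀ : q₀ ∈ U.1) (hpq : p ≠ q) (hpq₀ : p₀ ≠ q₀) :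
    ∑ M : PMatch n, levelWeight n t C w U M * ((if M.2.partner p ∈ U.1 then (1 : ℝ) else 0) * (if M.2.partner q ∈ U.1 then (1 : ℝ) else 0)) =
      ∑ M : PMatch n, levelWeight n t C w U M * ((if M.2.partner p₀ ∈ U.1 then (1 : ℝ) else 0) * (if M.2.partner q₀ ∈ U.1 then (1 : ℝ) else 0)) := by
  by_cases h1 : p = q₀
  · subst h1
    -- `β(p,q) = β(q,p) = β(p₀', p)`-type chain: move the second argument first
    by_cases h2 : p₀ = q
    · subst h2
      exact pairSum_comm t C w U p p₀
    · -- β(p,q) = β(p₀,q)?? no: p = q₀. β(q₀,q) = β(q,q₀) = β(p₀,q₀) (first-arg constancy with second arg q₀: q, p₀ ≠ q₀)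
      rw [pairSum_comm t C w U p q]
      exact pairSum_eq_of_ne t C w hq hp₀ hpq.symm hpq₀
  · -- β(p,q) = β(p,q₀) via symmetry + first-arg constancy (second arg p: q, q₀ ≠ p), then β(p,q₀) = β(p₀,q₀)
    calc ∑ M : PMatch n, levelWeight n t C w U M * ((if M.2.partner p ∈ U.1 then (1 : ℝ) else 0) * (if M.2.partner q ∈ U.1 then (1 : ℝ) else 0))
        = ∑ M : PMatch n, levelWeight n t C w U M * ((if M.2.partner q ∈ U.1 then (1 : ℝ) else 0) * (if M.2.partner p ∈ U.1 then (1 : ℝ) else 0)) :=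
          pairSum_comm t C w U p q
      _ = ∑ M : PMatch n, levelWeight n t C w U M * ((if M.2.partner q₀ ∈ U.1 then (1 : ℝ) else 0) * (if M.2.partner p ∈ U.1 then (1 : ℝ) else 0)) :=
          pairSum_eq_of_ne t C w hq hq₀ hpq.symm (Ne.symm h1)
      _ = ∑ M : PMatch n, levelWeight n t C w U M * ((if M.2.partner p ∈ U.1 then (1 : ℝ) else 0) * (if M.2.partner q₀ ∈ U.1 then (1 : ℝ) else 0)) :=
          pairSum_comm t C w U q₀ p
      _ = ∑ M : PMatch n, levelWeight n t C w U M * ((if M.2.partner p₀ ∈ U.1 then (1 : ℝ) else 0) * (if M.2.partner q₀ ∈ U.1 then (1 : ℝ) else 0)) :=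
          pairSum_eq_of_ne t C w hp hp₀ h1 hpq₀

/-! ### §4 Row sums are level polynomials; the value of `β_U` -/

/-- `Σ_{q∈U} 1[π_M q ∈ U] = t − cc(U,M)` on a `t`-cut. [cite: Rothvoss2017, §2 (PDF p. 6)] -/
theorem sum_mem_partner_eq {U : OddSet n} {t : ℕ} (hU : U.1.card = t) (M : PMatch n) :
    ∑ q ∈ U.1, (if M.2.partner q ∈ U.1 then (1 : ℝ) else 0) = (t : ℝ) - (cc U M : ℝ) := by
  classical
  have h := sum_containment_eq U M
  rw [hU] at h
  rw [← h, ← Finset.sum_subset (Finset.subset_univ U.1)]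
  · exact sum_congr rfl fun q hq => by rw [if_pos hq, one_mul]
  · intro q _ hq; rw [if_neg hq, zero_mul]

/-- **THE VIRTUAL LEVEL MATCHES EVERY PAIR INSIDE THE CUT**: for an exact design of degree `D ≥ 2`, a `t`-cut `U` and `p, q ∈ U`:
`Σ_M W(U,M)·1[π_M p ∈ U]·1[π_M q ∈ U] = −1/#{t-cuts}`. [cite: Rothvoss2017, §2 (PDF p. 6)] [cite: Potechin2019, Example 3.4 (LIPIcs 124, 61:7)] -/
theorem pairSum_eq {t T D : ℕ} {Bv : ℝ} {C : Finset ℕ} {w : ℕ → ℝ} (hdes : IsExactDesign n t T D Bv C w) (hD : 2 ≤ D)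
    {U : OddSet n} (hU : U.1.card = t) {p q : Fin n} (hp : p ∈ U.1) (hq : q ∈ U.1) :
    ∑ M : PMatch n, levelWeight n t C w U M * ((if M.2.partner p ∈ U.1 then (1 : ℝ) else 0) * (if M.2.partner q ∈ U.1 then (1 : ℝ) else 0)) =
      -1 / ((univ.filter fun U' : OddSet n => U'.1.card = t).card : ℝ) := by
  classical
  set N : ℝ := ((univ.filter fun U' : OddSet n => U'.1.card = t).card : ℝ) with hN
  set y : PMatch n → Fin n → ℝ := fun M q => if M.2.partner q ∈ U.1 then (1 : ℝ) else 0 with hy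
  set β : Fin n → Fin n → ℝ := fun p q => ∑ M : PMatch n, levelWeight n t C w U M * (y M p * y M q) with hβ
  change β p q = -1 / N
  -- `t ≥ 3`
  have hTt := hdes.2.2.1
  have hC := hdes.2.2.2.1
  have hnorm := hdes.2.2.2.2.1
  have ht3 : 3 ≤ t := by
    have hCne : C.Nonempty := by
      by_contra h0; rw [not_nonempty_iff_eq_empty] at h0; rw [h0, sum_empty] at hnorm; exact zero_ne_one hnorm
    obtain ⟨c, hc⟩ := hCne
    obtain ⟨-, h3c, hcT, -⟩ := hC c hc
    omega
  have htR : (3 : ℝ) ≤ t := by exact_mod_cast ht3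
  -- (R5) the diagonal row sum: `Σ_{p∈U} β(p,p) = Σ_M W (t − cc) = −t/N`
  have hy2 : ∀ M q, y M q * y M q = y M q := fun M q => by rw [hy]; dsimp only; split_ifs <;> norm_num
  have hdiag_sum : ∑ p' ∈ U.1, β p' p' = -(t : ℝ) / N := by
    calc ∑ p' ∈ U.1, β p' p' = ∑ M : PMatch n, levelWeight n t C w U M * ∑ p' ∈ U.1, y M p' := by
          rw [hβ]; dsimp only
          rw [sum_comm]
          refine sum_congr rfl fun M _ => ?_
          rw [mul_sum]
          exact sum_congr rfl fun p' _ => by rw [hy2]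
      _ = ∑ M : PMatch n, levelWeight n t C w U M * (Polynomial.C (t : ℝ) - X).eval ((cc U M : ℕ) : ℝ) := by
          refine sum_congr rfl fun M _ => ?_
          rw [hy]; dsimp only
          rw [sum_mem_partner_eq hU M, eval_sub, eval_C, eval_X]
      _ = -(t : ℝ) / N := by
          rw [sum_levelWeight_mul_eval_eq hdes _ (by
            refine (natDegree_sub_le _ _).trans (max_le ?_ ?_)
            · rw [natDegree_C]; exact Nat.zero_le _
            · rw [natDegree_X]; omega) hU]
          rw [hN]; simp
  -- (R4) the full double sum: `Σ_{p,q∈U} β(p,q) = Σ_M W (t − cc)² = −t²/N`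
  have hall_sum : ∑ p' ∈ U.1, ∑ q' ∈ U.1, β p' q' = -(t : ℝ) ^ 2 / N := by
    calc ∑ p' ∈ U.1, ∑ q' ∈ U.1, β p' q' = ∑ M : PMatch n, levelWeight n t C w U M * (∑ p' ∈ U.1, y M p') ^ 2 := by
          rw [hβ]; dsimp only
          calc ∑ p' ∈ U.1, ∑ q' ∈ U.1, ∑ M : PMatch n, levelWeight n t C w U M * (y M p' * y M q')
              = ∑ p' ∈ U.1, ∑ M : PMatch n, ∑ q' ∈ U.1, levelWeight n t C w U M * (y M p' * y M q') :=
                sum_congr rfl fun p' _ => sum_comm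
            _ = ∑ M : PMatch n, ∑ p' ∈ U.1, ∑ q' ∈ U.1, levelWeight n t C w U M * (y M p' * y M q') := sum_comm
            _ = ∑ M : PMatch n, levelWeight n t C w U M * (∑ p' ∈ U.1, y M p') ^ 2 := by
                refine sum_congr rfl fun M _ => ?_
                rw [sq, sum_mul_sum, mul_sum]
                refine sum_congr rfl fun p' _ => ?_
                rw [mul_sum]
      _ = ∑ M : PMatch n, levelWeight n t C w U M * ((Polynomial.C (t : ℝ) - X) ^ 2).eval ((cc U M : ℕ) : ℝ) := by
          refine sum_congr rfl fun M _ => ?_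
          rw [sum_mem_partner_eq hU M, eval_pow, eval_sub, eval_C, eval_X]
      _ = -(t : ℝ) ^ 2 / N := by
          rw [sum_levelWeight_mul_eval_eq hdes _ (by
            refine natDegree_pow_le.trans ?_
            have : (Polynomial.C (t : ℝ) - X).natDegree ≤ 1 := by
              refine (natDegree_sub_le _ _).trans (max_le ?_ ?_)
              · rw [natDegree_C]; exact Nat.zero_le _
              · rw [natDegree_X]
            omega) hU]
          rw [hN]; simp
  -- a second vertex of `U`
  have hU2 : ∃ q₀ ∈ U.1, q₀ ≠ p := by
    by_contra h0
    push Not at h0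
    have : U.1 ⊆ {p} := fun x hx => mem_singleton.2 (h0 x hx)
    have := card_le_card this
    rw [card_singleton, hU] at this
    omega
  obtain ⟨q₀, hq₀, hq₀p⟩ := hU2
  -- constancy: diagonal = β p p, off-diagonal = β p q₀
  have hdiag : ∀ p' ∈ U.1, β p' p' = β p p := fun p' hp' => pairSum_diag_eq t C w hp' hp
  have hoff : ∀ p' ∈ U.1, ∀ q' ∈ U.1, p' ≠ q' → β p' q' = β p q₀ := fun p' hp' q' hq' hne =>
    pairSum_offDiag_eq t C w hp' hq' hp hq₀ hne hq₀p.symm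
  -- evaluate the two sums through the constants
  have hdiag_sum' : ∑ p' ∈ U.1, β p' p' = (t : ℝ) * β p p := by
    rw [sum_congr rfl hdiag, sum_const, nsmul_eq_mul, hU]
  have hall_sum' : ∑ p' ∈ U.1, ∑ q' ∈ U.1, β p' q' = (t : ℝ) * β p p + (t : ℝ) * ((t : ℝ) - 1) * β p q₀ := by
    have hrow : ∀ p' ∈ U.1, ∑ q' ∈ U.1, β p' q' = β p p + ((t : ℝ) - 1) * β p q₀ := by
      intro p' hp'
      rw [← Finset.add_sum_erase U.1 (fun q' => β p' q') hp', hdiag p' hp']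
      congr 1
      rw [sum_congr rfl fun q' hq' => hoff p' hp' q' (mem_of_mem_erase hq') (ne_of_mem_erase hq').symm, sum_const, nsmul_eq_mul,
        card_erase_of_mem hp', hU]
      have : ((t - 1 : ℕ) : ℝ) = (t : ℝ) - 1 := by rw [Nat.cast_sub (by omega)]; simp
      rw [this]
    rw [sum_congr rfl hrow, sum_const, nsmul_eq_mul, hU]
    ring
  -- solve: β p p = −1/N, β p q₀ = −1/N
  have hN0 : N ≠ 0 := by
    rw [hN]
    have : U ∈ univ.filter (fun U' : OddSet n => U'.1.card = t) := mem_filter.2 ⟨mem_univ _, hU⟩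
    exact_mod_cast (card_pos.2 ⟨U, this⟩).ne'
  have hpp : β p p = -1 / N := by
    have h := hdiag_sum
    rw [hdiag_sum'] at h
    have ht0 : (t : ℝ) ≠ 0 := by linarith
    have h2 : (t : ℝ) * β p p = (t : ℝ) * (-1 / N) := by rw [h]; ring
    exact mul_left_cancel₀ ht0 h2
  have hpq₀ : β p q₀ = -1 / N := by
    have h := hall_sum
    rw [hall_sum', hpp] at h
    have ht0 : (t : ℝ) * ((t : ℝ) - 1) ≠ 0 := by
      apply mul_ne_zero <;> linarith
    have h2 : (t : ℝ) * ((t : ℝ) - 1) * β p q₀ = (t : ℝ) * ((t : ℝ) - 1) * (-1 / N) := by linear_combination h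
    exact mul_left_cancel₀ ht0 h2
  by_cases hpq : p = q
  · subst hpq; exact hpp
  · rw [hoff p hp q hq hpq]; exact hpq₀

/-! ### §5 The matching-average of the pair-containment form is minus the second moment of the linear form -/

/-- **`L_u = C_u` VIRTUALLY.** For an exact design of degree `D ≥ 2`, every `f : cuts → ℝ` and every fixed `u : Fin n → ℝ`:
`Σ_U Σ_M W(U,M)·f(U)·(Σ_p u_p x_p x_{π_M p})² = −(#t-cuts)⁻¹·Σ_{|U|=t} f(U)·(Σ_{p∈U} u_p)²`.
[cite: Rothvoss2017, §2 (PDF p. 6)] [cite: Potechin2019, Example 3.4 (LIPIcs 124, 61:7)] [cite: GriblingDelaatLaurent2019, §5] -/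
theorem sum_containment_sq_eq_linear {t T D : ℕ} {Bv : ℝ} {C : Finset ℕ} {w : ℕ → ℝ} (hdes : IsExactDesign n t T D Bv C w) (hD : 2 ≤ D)
    (f : OddSet n → ℝ) (u : Fin n → ℝ) :
    ∑ U : OddSet n, ∑ M : PMatch n, levelWeight n t C w U M *
        (f U * (∑ p, u p * ((if p ∈ U.1 then (1 : ℝ) else 0) * (if M.2.partner p ∈ U.1 then (1 : ℝ) else 0))) ^ 2) =
      -(∑ U ∈ univ.filter (fun U : OddSet n => U.1.card = t), f U * (∑ p ∈ U.1, u p) ^ 2) /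
        ((univ.filter fun U' : OddSet n => U'.1.card = t).card : ℝ) := by
  classical
  set N : ℝ := ((univ.filter fun U' : OddSet n => U'.1.card = t).card : ℝ) with hN
  -- per cut
  have hcut : ∀ U : OddSet n, ∑ M : PMatch n, levelWeight n t C w U M *
      (f U * (∑ p, u p * ((if p ∈ U.1 then (1 : ℝ) else 0) * (if M.2.partner p ∈ U.1 then (1 : ℝ) else 0))) ^ 2) =
      if U.1.card = t then -(f U * (∑ p ∈ U.1, u p) ^ 2) / N else 0 := by
    intro U
    by_cases hU : U.1.card = t
    · rw [if_pos hU]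
      -- expand the square over `p, q ∈ U`
      have hsq : ∀ M : PMatch n, (∑ p, u p * ((if p ∈ U.1 then (1 : ℝ) else 0) * (if M.2.partner p ∈ U.1 then (1 : ℝ) else 0))) ^ 2 =
          ∑ p ∈ U.1, ∑ q ∈ U.1, u p * u q *
            ((if M.2.partner p ∈ U.1 then (1 : ℝ) else 0) * (if M.2.partner q ∈ U.1 then (1 : ℝ) else 0)) := by
        intro M
        have hred : ∑ p, u p * ((if p ∈ U.1 then (1 : ℝ) else 0) * (if M.2.partner p ∈ U.1 then (1 : ℝ) else 0)) =
            ∑ p ∈ U.1, u p * (if M.2.partner p ∈ U.1 then (1 : ℝ) else 0) := by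
          rw [← Finset.sum_subset (Finset.subset_univ U.1)]
          · exact sum_congr rfl fun p hp => by rw [if_pos hp, one_mul]
          · intro p _ hp; rw [if_neg hp, zero_mul, mul_zero]
        rw [hred, sq, sum_mul_sum]
        exact sum_congr rfl fun p _ => sum_congr rfl fun q _ => by ring
      simp_rw [hsq, mul_sum]
      rw [sum_comm]
      have hinner : ∀ p ∈ U.1, ∑ M : PMatch n, ∑ q ∈ U.1, levelWeight n t C w U M * (f U * (u p * u q *
          ((if M.2.partner p ∈ U.1 then (1 : ℝ) else 0) * (if M.2.partner q ∈ U.1 then (1 : ℝ) else 0)))) =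
          ∑ q ∈ U.1, f U * (u p * u q) * (-1 / N) := by
        intro p hp
        rw [sum_comm]
        refine sum_congr rfl fun q hq => ?_
        rw [← pairSum_eq hdes hD hU hp hq, mul_sum]
        exact sum_congr rfl fun M _ => by ring
      rw [sum_congr rfl hinner]
      calc ∑ p ∈ U.1, ∑ q ∈ U.1, f U * (u p * u q) * (-1 / N)
          = (f U * (-1 / N)) * ∑ p ∈ U.1, ∑ q ∈ U.1, u p * u q := by
            rw [mul_sum]
            refine sum_congr rfl fun p _ => ?_
            rw [mul_sum]
            exact sum_congr rfl fun q _ => by ring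
        _ = (f U * (-1 / N)) * (∑ p ∈ U.1, u p) ^ 2 := by rw [sq, sum_mul_sum]
        _ = -(f U * (∑ p ∈ U.1, u p) ^ 2) / N := by ring
    · rw [if_neg hU]
      refine sum_eq_zero fun M _ => ?_
      have h0 : levelWeight n t C w U M = 0 := by
        unfold levelWeight
        exact sum_eq_zero fun c _ => by rw [if_neg]; exact fun h => hU (mem_Qset_iff.1 h).1
      rw [h0, zero_mul]
  rw [sum_congr rfl fun U _ => hcut U, ← sum_filter]
  simp_rw [neg_div]
  rw [Finset.sum_div, ← Finset.sum_neg_distrib]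

/-- **BALANCED SLABS ARE MEAN-ZERO.** If `f` vanishes off the slab `{U : Σ_{p∈U} u_p = 0}` (e.g. `f = 1[|U∩H₁| = |U∩H₂|]`, `u = χ_{H₁} − χ_{H₂}`),
then `Σ_M Σ_U W(U,M) f(U) (Σ_p u_p x_p x_{π_M p})² = 0` exactly (design of degree `D ≥ 2`): (CG_1') in the fixed direction `u` is then the
two-sided statement that `|Q^f_M(u)|` is small for essentially every `M`. [cite: Rothvoss2017, §2 (PDF p. 6)] [cite: GriblingDelaatLaurent2019, §5] -/
theorem sum_containment_sq_eq_zero_of_slab {t T D : ℕ} {Bv : ℝ} {C : Finset ℕ} {w : ℕ → ℝ} (hdes : IsExactDesign n t T D Bv C w)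
    (hD : 2 ≤ D) (f : OddSet n → ℝ) (u : Fin n → ℝ) (hslab : ∀ U : OddSet n, ∑ p ∈ U.1, u p ≠ 0 → f U = 0) :
    ∑ M : PMatch n, ∑ U : OddSet n, levelWeight n t C w U M *
        (f U * (∑ p, u p * ((if p ∈ U.1 then (1 : ℝ) else 0) * (if M.2.partner p ∈ U.1 then (1 : ℝ) else 0))) ^ 2) = 0 := by
  rw [sum_comm, sum_containment_sq_eq_linear hdes hD f u]
  have : ∑ U ∈ univ.filter (fun U : OddSet n => U.1.card = t), f U * (∑ p ∈ U.1, u p) ^ 2 = 0 := by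
    refine sum_eq_zero fun U _ => ?_
    by_cases h : ∑ p ∈ U.1, u p = 0
    · rw [h]; ring
    · rw [hslab U h]; ring
  rw [this, neg_zero, zero_div]

end Summit.PneNP.PneNP.Theorems.ChebyshevTracialDesignPairContainmentMean
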